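import Literature.NumberTheory.LFunctions.YoshidaWindowGramFrontDoorW
import HarnessLib

/-!
# Kernel enclosures of Yoshida's matrix coefficients — IX: certified column DATA and integer Schur sums (column-band `U₁`)

Source: H. Yoshida, Adv. Stud. Pure Math. **21** (1992) 281–325, §§5–7 [Yoshida1992HermitianForms] (the matrix
coefficients and the finite Schur-complement certificate); R. E. Moore, *Interval Analysis* (1966), Ch. 3 [Moore1966]
(inclusion property).

The format-C front door asks per sector for an entrywise enclosure of the Schur matrix
`S(i,j) = M(i,j) − Σ_{t<K} M(i,B+t)M(j,B+t)/w_t − U₂(i,j)` (`M` the sector kernel of `gramCoeff a`, `B` block modes,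
`K = B₃ − B` coupling columns).  Parts V/VI evaluate the column sum INSIDE each row-band declaration over the interval
column list (`checkFrontRowsAux(W)` + `colList`): every band re-pays all `B·K` column boxes and `k·B·K` interval
products, which the per-declaration kernel memory cap limits to `K ≲ 40` (rh-explicit weil-2, KERNEL-CAP.md /
COLBAND-U1.md).  Production rungs (`B = 160…256`, `K = 160…448`) need the columns as CERTIFIED INTEGER DATA and the
Schur sum as an EXACT INTEGER dot product per output entry.  This file supplies, abstractly in the enclosed functions:

* `Encl.DataNear f B K w o c ρ XP` — the PACKED natural data (one literal per row `i < B`; `K` digits of `w` bits,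
  `Encl.unpackNats`, read by structural recursion; signed value `digit − o`, `o = 2^{w−1}`; unit `2^{−c}`, radius `ρ`)
  encloses `f i t`; `Encl.checkRect` — a rectangle of `enclCheck`s against any box function `box i t`,
  `Encl.near_of_checkRect`, and the digit-range glue `DataNear.extend`; instance: the coupling columns
  `f i t = M^σ(i, B+t)` against `sectorColBox` (`Encl.colDataNear_of_checkRect`);
* `Encl.dotN3 v x y = Σ_t v_t x_t y_t`, `Encl.dotN2`, `Encl.sumList` over `ℕ` lists (the kernel reduces these with its
  GMP-backed `Nat` arithmetic: measured 0.06–0.1 ms per term, 3× faster than `ℤ` data), per-row weighted digit sums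
  as data (`Encl.checkRowDots` ⇒ `Encl.RowDots`, the offset correction);
* `Encl.gramDataBox` — the box `[(Tz − E), (Tz + E)]·2^{−(cL+cR+cv)}` of the weighted Gram entry
  `Σ_{t<K} f(i,t)·g(j,t)·v_t·2^{−cv}` from two certified data families (`Tz = dotN3 v XL[i] XR[j] − o·PL[i] − o·PR[j]
  + o²·Σv`, `E = (Σv)·(ρL·o + ρR·o + ρL·ρR)`), `Encl.mem_gramDataBox` — the one real estimate of the layer;
  the column sum `U₁` is the case `f = g = ` columns, `v_t = ` reciprocal dyadic weights (`w_t = 2^{cv}/v_t`,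
  `Encl.wvF`); a low-rank tail `U₂ = Σ_r φ_r ψ_rᵀ` is the case `f = φ`, `g = ψ`, `v = 1`;
* `Encl.checkWeightsEvenV` / `Encl.checkWeightsOddV` — reciprocal-weight certificates `2^{cv}·S ≤ v_t·box.lo` against
  the far-diagonal boxes `devEvenBox` / `devOddABox` (parts V-b/VI), unpacked by `weightsEvenV_of_check` /
  `weightsOddV_of_check` to the box level (the step `box.lo ≤ d̂·S` is the caller's: `devEvenBox_lo_le(_A)` …);
* `Encl.checkSchurBandG` — a row band (full rows or lower triangle) of `enclCheck`s of
  `sectorBoxSym(i,j) − sub(i,j)` against the claimed midpoints `DS` for ANY box function `sub` of the subtracted part,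
  `Encl.near_schurG_of_check` (soundness, given `Usub i j ∈ sub i j`), and the real entry `Encl.schurEntryG`.

Everything is proved; no named facts; no new analytic content (the kits in `Summits/…/WeilFormatCDataKit*.lean`
compose these with the doors).
-/

open Real Complex Finset Matrix
open scoped BigOperators

namespace Literature.NumberTheory.LFunctions.Yoshida1992

open Literature.Analysis.SpecialFunctions Literature.Analysis.ValidatedNumerics.NumericsMP
open Literature.Analysis.ValidatedNumerics

namespace Encl

variable {S : ℕ} {a : ℝ} {ks : List PrimeLen} {C : Consts} {tab ctab : List IdxRec}

/-! ## Certified two-index data: packed natural rows, digit `t` of row `i` read with an offset -/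

/-- Unpack `k` words of width `w` bits of the natural `r` (least significant first): the packed data row `r`
holds the digits `X[t] = (r / 2^{wt}) % 2^w`, `t < k`. [cite: Moore1966, Ch. 3 (interval arithmetic: inclusion property)] -/
def unpackNats (w : ℕ) (r : ℕ) : ℕ → List ℕ
  | 0 => []
  | k + 1 => (r % 2 ^ w) :: unpackNats w (r / 2 ^ w) k

/-- [cite: Moore1966, Ch. 3 (interval arithmetic: inclusion property)] -/
theorem length_unpackNats (w r : ℕ) : ∀ k, (unpackNats w r k).length = k
  | 0 => rfl
  | k + 1 => by
      rw [unpackNats, List.length_cons, length_unpackNats]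

/-- Every digit is `< 2^w`. [cite: Moore1966, Ch. 3 (interval arithmetic: inclusion property)] -/
theorem unpackNats_getD_lt (w : ℕ) : ∀ (r k t : ℕ), (unpackNats w r k).getD t 0 < 2 ^ w
  | r, 0, t => by simp [unpackNats]
  | r, k + 1, 0 => by simpa [unpackNats] using Nat.mod_lt r (by positivity)
  | r, k + 1, t + 1 => by simpa [unpackNats, List.getD_cons_succ] using unpackNats_getD_lt w (r / 2 ^ w) k t

/-- Digit `t` of the packed row `i` of `XP` (word width `w`, `K` digits). [cite: Moore1966, Ch. 3 (interval arithmetic: inclusion property)] -/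
def digit (w K : ℕ) (XP : List ℕ) (i t : ℕ) : ℕ := (unpackNats w (XP.getD i 0) K).getD t 0

/-- The packed natural data `XP` (word width `w`, `K` digits per row, offset `o`, unit `2^{−c}`, radius `ρ`) encloses
`f i t` for `i < B`, `t < K`: `|f i t − (digit − o)·2^{−c}| ≤ ρ·2^{−c}`. [cite: Moore1966, Ch. 3 (interval arithmetic: inclusion property)] -/
def DataNear (f : ℕ → ℕ → ℝ) (B K w o c ρ : ℕ) (XP : List ℕ) : Prop :=
  ∀ i < B, ∀ t < K, |f i t - (((digit w K XP i t : ℤ) - o : ℤ) : ℝ) * (1 / 2 ^ c)| ≤ (ρ : ℝ) * (1 / 2 ^ c)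

/-- Check the digit segment `ds` (digits `t₀, t₀+1, …` of row `i`) against the boxes `box i t` (offset `o`).
[cite: Moore1966, Ch. 3 (interval arithmetic: inclusion property)] -/
def checkSeg (S c : ℕ) (ρ : ℤ) (o : ℕ) (box : ℕ → ℕ → MI) (i : ℕ) : ℕ → List ℕ → Bool
  | _, [] => true
  | t, d :: ds => enclCheck S c ρ ((d : ℤ) - o) (box i t) && checkSeg S c ρ o box i (t + 1) ds

/-- Check the rectangle rows `i₀ ≤ i < i₀ + ki`, digits `t₀ ≤ t < t₀ + kt` (of the `K` digits) of `XP` against `box`.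
[cite: Moore1966, Ch. 3 (interval arithmetic: inclusion property)] -/
def checkRect (S c : ℕ) (ρ : ℤ) (w K o : ℕ) (box : ℕ → ℕ → MI) (XP : List ℕ) (i0 ki t0 kt : ℕ) : Bool :=
  decide (t0 + kt ≤ K) &&
    (List.range ki).all fun di ↦
      checkSeg S c ρ o box (i0 + di) t0 (((unpackNats w (XP.getD (i0 + di) 0) K).drop t0).take kt)

/-- What `checkSeg` certifies, digit by digit. [cite: Moore1966, Ch. 3 (interval arithmetic: inclusion property)] -/
theorem checkSeg_spec {S c : ℕ} {ρ : ℤ} {o : ℕ} {box : ℕ → ℕ → MI} {i : ℕ} :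
    ∀ (t0 : ℕ) (ds : List ℕ), checkSeg S c ρ o box i t0 ds = true →
      ∀ s < ds.length, enclCheck S c ρ ((ds.getD s 0 : ℤ) - o) (box i (t0 + s)) = true
  | _, [], _, s, hs => absurd hs (by simp)
  | t0, d :: ds, h, s, hs => by
      rw [checkSeg, Bool.and_eq_true] at h
      cases s with
      | zero => simpa using h.1
      | succ s =>
        have := checkSeg_spec (t0 + 1) ds h.2 s (by simpa using hs)
        simpa [List.getD_cons_succ, show t0 + 1 + s = t0 + (s + 1) by omega] using this

/-- **Soundness of `checkRect`**: on the rectangle, `|f i t − (digit − o)·2^{−c}| ≤ ρ·2^{−c}`, given `f i t ∈ box i t`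
there. [cite: Moore1966, Ch. 3 (interval arithmetic: inclusion property)] -/
theorem near_of_checkRect (hS : 0 < S) {c : ℕ} {ρ : ℤ} {w K o : ℕ} {box : ℕ → ℕ → MI} {XP : List ℕ}
    {i0 ki t0 kt : ℕ} {f : ℕ → ℕ → ℝ}
    (hbox : ∀ i, i0 ≤ i → i < i0 + ki → ∀ t, t0 ≤ t → t < t0 + kt → MI.mem S (f i t) (box i t))
    (h : checkRect S c ρ w K o box XP i0 ki t0 kt = true) {i t : ℕ} (hi : i0 ≤ i) (hik : i < i0 + ki)
    (ht : t0 ≤ t) (htk : t < t0 + kt) :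
    |f i t - (((digit w K XP i t : ℤ) - o : ℤ) : ℝ) * (1 / 2 ^ c)| ≤ (ρ : ℝ) * (1 / 2 ^ c) := by
  unfold checkRect at h
  rw [Bool.and_eq_true, decide_eq_true_eq, List.all_eq_true] at h
  obtain ⟨hK, h⟩ := h
  have hseg := h (i - i0) (List.mem_range.mpr (by omega))
  rw [show i0 + (i - i0) = i by omega] at hseg
  have hs : t - t0 < (((unpackNats w (XP.getD i 0) K).drop t0).take kt).length := by
    simp only [List.length_take, List.length_drop, length_unpackNats]; omega
  have h2 := checkSeg_spec t0 _ hseg (t - t0) hs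
  rw [show t0 + (t - t0) = t by omega] at h2
  have e : (((unpackNats w (XP.getD i 0) K).drop t0).take kt).getD (t - t0) 0 = digit w K XP i t := by
    unfold digit
    rw [List.getD_eq_getElem?_getD, List.getElem?_take_of_lt (by omega), List.getElem?_drop,
      show t0 + (t - t0) = t by omega, ← List.getD_eq_getElem?_getD]
  rw [e] at h2
  exact abs_sub_le_of_enclCheck hS h2 (hbox i hi hik t ht htk)

/-- Glue: no digits yet. [cite: Moore1966, Ch. 3 (interval arithmetic: inclusion property)] -/
theorem DataNear.zero {f : ℕ → ℕ → ℝ} {B w o c ρ : ℕ} {XP : List ℕ} (K : ℕ) :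
    ∀ i < B, ∀ t < 0, |f i t - (((digit w K XP i t : ℤ) - o : ℤ) : ℝ) * (1 / 2 ^ c)| ≤ (ρ : ℝ) * (1 / 2 ^ c) :=
  fun _ _ _ ht ↦ absurd ht (by omega)

/-- Glue a further digit range `[n, n + kt)` (a checked rectangle over all rows `i < B`).
[cite: Moore1966, Ch. 3 (interval arithmetic: inclusion property)] -/
theorem DataNear.extend {f : ℕ → ℕ → ℝ} {B K w o c ρ n kt : ℕ} {XP : List ℕ}
    (h1 : ∀ i < B, ∀ t < n, |f i t - (((digit w K XP i t : ℤ) - o : ℤ) : ℝ) * (1 / 2 ^ c)| ≤ (ρ : ℝ) * (1 / 2 ^ c))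
    (h2 : ∀ i < B, ∀ t, n ≤ t → t < n + kt →
      |f i t - (((digit w K XP i t : ℤ) - o : ℤ) : ℝ) * (1 / 2 ^ c)| ≤ (ρ : ℝ) * (1 / 2 ^ c)) :
    ∀ i < B, ∀ t < n + kt, |f i t - (((digit w K XP i t : ℤ) - o : ℤ) : ℝ) * (1 / 2 ^ c)| ≤ (ρ : ℝ) * (1 / 2 ^ c) :=
  fun i hi t ht ↦ if h : t < n then h1 i hi t h else h2 i hi t (by omega) ht

/-- Glue along ROWS: no rows yet. [cite: Moore1966, Ch. 3 (interval arithmetic: inclusion property)] -/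
theorem DataNear.zeroRows {f : ℕ → ℕ → ℝ} {K w o c ρ : ℕ} {XP : List ℕ} : DataNear f 0 K w o c ρ XP :=
  fun _ hi ↦ absurd hi (by omega)

/-- Glue along ROWS: a further row band `[n, n + ki)` over all digits `t < K` (the cheap chunk shape: each
declaration unpacks only its own `ki` rows). [cite: Moore1966, Ch. 3 (interval arithmetic: inclusion property)] -/
theorem DataNear.extendRows {f : ℕ → ℕ → ℝ} {K w o c ρ n ki : ℕ} {XP : List ℕ} (h1 : DataNear f n K w o c ρ XP)
    (h2 : ∀ i, n ≤ i → i < n + ki → ∀ t < K,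
      |f i t - (((digit w K XP i t : ℤ) - o : ℤ) : ℝ) * (1 / 2 ^ c)| ≤ (ρ : ℝ) * (1 / 2 ^ c)) :
    DataNear f (n + ki) K w o c ρ XP :=
  fun i hi t ht ↦ if h : i < n then h1 i h t ht else h2 i (by omega) hi t ht

/-- **Stage C for the coupling columns**: a checked rectangle of column data (rows `[i₀, i₀+ki)` below `B`, digits
`[t₀, t₀+kt)`, boxes `sectorColBox`) encloses `M^σ(i, B + t)`; tables: full below `B + 1`, light on `[B, B + K + 1)`.
[cite: Yoshida1992HermitianForms, §6 (6.10) p. 303] -/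
theorem colDataNear_of_checkRect (hS : 0 < S) (ha0 : 0 < a) (hks : PrimeData a ks) (hC : ConstsValid S a ks C)
    {B K : ℕ} (hB : 1 ≤ B) (hT : TabValid S a ks (B + 1) tab) (hCT : TabColValid S a ks B (B + K + 1) ctab)
    (odd : Bool) {c : ℕ} {ρ : ℤ} {w o : ℕ} {XP : List ℕ} {i0 ki t0 kt : ℕ} (hki : i0 + ki ≤ B)
    (h : checkRect S c ρ w K o (fun i t ↦ sectorColBox odd S C tab ctab i (B + t)) XP i0 ki t0 kt = true)
    {i t : ℕ} (hi : i0 ≤ i) (hik : i < i0 + ki) (ht : t0 ≤ t) (htk : t < t0 + kt) :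
    |sectorKernel odd (gramCoeff a) i (B + t) - (((digit w K XP i t : ℤ) - o : ℤ) : ℝ) * (1 / 2 ^ c)|
      ≤ (ρ : ℝ) * (1 / 2 ^ c) := by
  have hK : t0 + kt ≤ K := by
    unfold checkRect at h; rw [Bool.and_eq_true, decide_eq_true_eq] at h; exact h.1
  exact near_of_checkRect hS (f := fun i t ↦ sectorKernel odd (gramCoeff a) i (B + t))
    (fun i _ hik t _ htk ↦ mem_sectorColBox hS ha0 hks hC hB hT hCT odd (by omega) (by omega)) h hi hik ht htk

/-- **Stage C, row-band form**: the column data below row `n` extends to below `n + ki` by one checked row band over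
all `K` digits. [cite: Yoshida1992HermitianForms, §6 (6.10) p. 303] -/
theorem colDataNear_extendRows (hS : 0 < S) (ha0 : 0 < a) (hks : PrimeData a ks) (hC : ConstsValid S a ks C)
    {B K : ℕ} (hB : 1 ≤ B) (hT : TabValid S a ks (B + 1) tab) (hCT : TabColValid S a ks B (B + K + 1) ctab)
    (odd : Bool) {c : ℕ} {ρ : ℤ} {w o : ℕ} {XP : List ℕ} {n ki : ℕ} (hki : n + ki ≤ B) {ρn : ℕ} (hρ : ρ = (ρn : ℤ))
    (h1 : DataNear (fun i t ↦ sectorKernel odd (gramCoeff a) i (B + t)) n K w o c ρn XP)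
    (h : checkRect S c ρ w K o (fun i t ↦ sectorColBox odd S C tab ctab i (B + t)) XP n ki 0 K = true) :
    DataNear (fun i t ↦ sectorKernel odd (gramCoeff a) i (B + t)) (n + ki) K w o c ρn XP := by
  refine h1.extendRows fun i hi hik t ht ↦ ?_
  have := colDataNear_of_checkRect hS ha0 hks hC hB hT hCT odd hki h hi hik (Nat.zero_le t) (by simpa using ht)
  subst hρ
  exact_mod_cast this

/-! ## Natural-number dot products over the digits (kernel: GMP-backed `Nat` arithmetic only) -/

/-- `Σ_t v_t·x_t·y_t` over three lists of naturals, truncating (structural recursion). [cite: Moore1966, Ch. 3 (interval arithmetic: inclusion property)] -/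
def dotN3 : List ℕ → List ℕ → List ℕ → ℕ
  | v :: vs, x :: xs, y :: ys => v * (x * y) + dotN3 vs xs ys
  | _, _, _ => 0

/-- `Σ_t v_t·x_t` (structural). [cite: Moore1966, Ch. 3 (interval arithmetic: inclusion property)] -/
def dotN2 : List ℕ → List ℕ → ℕ
  | v :: vs, x :: xs => v * x + dotN2 vs xs
  | _, _ => 0

/-- Sum of a list of naturals (structural). [cite: Moore1966, Ch. 3 (interval arithmetic: inclusion property)] -/
def sumList : List ℕ → ℕ
  | [] => 0
  | v :: vs => v + sumList vs

/-- [cite: Moore1966, Ch. 3 (interval arithmetic: inclusion property)] -/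
theorem dotN3_eq_sum : ∀ (v x y : List ℕ) (K : ℕ), v.length = K → x.length = K → y.length = K →
    (dotN3 v x y : ℝ) = ∑ t ∈ Finset.range K, (v.getD t 0 : ℝ) * ((x.getD t 0 : ℝ) * (y.getD t 0 : ℝ))
  | [], _, _, K, hv, _, _ => by subst hv; simp [dotN3]
  | _ :: _, [], _, K, hv, hx, _ => by simp at hx hv; omega
  | _ :: _, _ :: _, [], K, hv, _, hy => by simp at hy hv; omega
  | v :: vs, x :: xs, y :: ys, K, hv, hx, hy => by
      obtain ⟨K, rfl⟩ : ∃ K', K = K' + 1 := ⟨K - 1, by simp at hv; omega⟩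
      rw [dotN3, Finset.sum_range_succ']
      simp only [List.getD_cons_succ, List.getD_cons_zero]
      push_cast
      rw [dotN3_eq_sum vs xs ys K (by simpa using hv) (by simpa using hx) (by simpa using hy)]; ring

/-- [cite: Moore1966, Ch. 3 (interval arithmetic: inclusion property)] -/
theorem dotN2_eq_sum : ∀ (v x : List ℕ) (K : ℕ), v.length = K → x.length = K →
    (dotN2 v x : ℝ) = ∑ t ∈ Finset.range K, (v.getD t 0 : ℝ) * (x.getD t 0 : ℝ)
  | [], _, K, hv, _ => by subst hv; simp [dotN2]
  | _ :: _, [], K, hv, hx => by simp at hx hv; omega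
  | v :: vs, x :: xs, K, hv, hx => by
      obtain ⟨K, rfl⟩ : ∃ K', K = K' + 1 := ⟨K - 1, by simp at hv; omega⟩
      rw [dotN2, Finset.sum_range_succ']
      simp only [List.getD_cons_succ, List.getD_cons_zero]
      push_cast
      rw [dotN2_eq_sum vs xs K (by simpa using hv) (by simpa using hx)]; ring

/-- [cite: Moore1966, Ch. 3 (interval arithmetic: inclusion property)] -/
theorem sumList_eq_sum : ∀ (v : List ℕ) (K : ℕ), v.length = K → (sumList v : ℝ) = ∑ t ∈ Finset.range K, (v.getD t 0 : ℝ)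
  | [], K, hv => by subst hv; simp [sumList]
  | v :: vs, K, hv => by
      obtain ⟨K, rfl⟩ : ∃ K', K = K' + 1 := ⟨K - 1, by simp at hv; omega⟩
      rw [sumList, Finset.sum_range_succ']
      simp only [List.getD_cons_succ, List.getD_cons_zero]
      push_cast
      rw [sumList_eq_sum vs K (by simpa using hv)]; ring

/-- Per-row weighted digit sums as data: `P[i] = Σ_t v_t·X[i][t]` for the rows `i₀ ≤ i < i₀ + k`.
[cite: Moore1966, Ch. 3 (interval arithmetic: inclusion property)] -/
def checkRowDots (w K : ℕ) (XP : List ℕ) (v : List ℕ) (P : List ℕ) (i0 k : ℕ) : Bool :=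
  (List.range k).all fun di ↦ decide (dotN2 v (unpackNats w (XP.getD (i0 + di) 0) K) = P.getD (i0 + di) 0)

/-- The rows below `n` have their weighted digit sums in `P`. [cite: Moore1966, Ch. 3 (interval arithmetic: inclusion property)] -/
def RowDots (w K : ℕ) (XP v P : List ℕ) (n : ℕ) : Prop :=
  ∀ i < n, dotN2 v (unpackNats w (XP.getD i 0) K) = P.getD i 0

/-- [cite: Moore1966, Ch. 3 (interval arithmetic: inclusion property)] -/
theorem RowDots.zero {w K : ℕ} {XP v P : List ℕ} : RowDots w K XP v P 0 := fun _ h ↦ absurd h (by omega)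

/-- [cite: Moore1966, Ch. 3 (interval arithmetic: inclusion property)] -/
theorem RowDots.extend {w K : ℕ} {XP v P : List ℕ} {n k : ℕ} (h1 : RowDots w K XP v P n)
    (h2 : checkRowDots w K XP v P n k = true) : RowDots w K XP v P (n + k) := by
  intro i hi
  by_cases h : i < n
  · exact h1 i h
  · unfold checkRowDots at h2
    rw [List.all_eq_true] at h2
    have := h2 (i - n) (List.mem_range.mpr (by omega))
    rw [decide_eq_true_eq, show n + (i - n) = i by omega] at this
    exact this

/-! ## The weighted Gram box from two certified data families -/

/-- The box `[(Tz − E)·U, (Tz + E)·U]`, `U = 2^{−(cL+cR+cv)}`, of the weighted Gram entry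
`Σ_{t<K} f(i,t)g(j,t)·v_t2^{−cv}`: `Tz = dotN3 v XL[i] XR[j] − oR·PL[i] − oL·PR[j] + oL·oR·V` (the offset-corrected
integer Gram entry of the digits) and `E = V·(ρL·oR + ρR·oL + ρL·ρR)` (radius; the digits satisfy `|X − o| ≤ o` for
`o = 2^{w−1}`). [cite: Moore1966, Ch. 3 (interval arithmetic: inclusion property)] -/
def gramDataBox (S w K cL cR cv ρL ρR oL oR : ℕ) (XL XR PL PR v : List ℕ) (V : ℕ) (i j : ℕ) : MI :=
  MI.span
    (MI.ofFrac S ((dotN3 v (unpackNats w (XL.getD i 0) K) (unpackNats w (XR.getD j 0) K) : ℤ)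
        - (oR * PL.getD i 0 : ℕ) - (oL * PR.getD j 0 : ℕ) + (oL * oR * V : ℕ)
        - (V * (ρL * oR + ρR * oL + ρL * ρR) : ℕ)) (2 ^ (cL + cR + cv)))
    (MI.ofFrac S ((dotN3 v (unpackNats w (XL.getD i 0) K) (unpackNats w (XR.getD j 0) K) : ℤ)
        - (oR * PL.getD i 0 : ℕ) - (oL * PR.getD j 0 : ℕ) + (oL * oR * V : ℕ)
        + (V * (ρL * oR + ρR * oL + ρL * ρR) : ℕ)) (2 ^ (cL + cR + cv)))

/-- **The weighted Gram entry from certified data.**  If the digits of `XL` (offset `oL = 2^{w−1}`, unit `2^{−cL}`,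
radius `ρL`, rows `< BL`) enclose `f` and those of `XR` (offset `oR = 2^{w−1}`, unit `2^{−cR}`, radius `ρR`, rows `< BR`)
enclose `g`, the weighted digit sums are `PL`, `PR`, `|v| = K` and `Σ v = V`, then
`Σ_{t<K} f(i,t)·g(j,t)·(v_t/2^{cv}) ∈ gramDataBox … i j`. [cite: Moore1966, Ch. 3 (interval arithmetic: inclusion property)] -/
theorem mem_gramDataBox (S : ℕ) {f g : ℕ → ℕ → ℝ} {BL BR K w cL cR cv ρL ρR : ℕ} {XL XR PL PR v : List ℕ} {V : ℕ}
    (hw : 1 ≤ w) (hL : DataNear f BL K w (2 ^ (w - 1)) cL ρL XL) (hR : DataNear g BR K w (2 ^ (w - 1)) cR ρR XR)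
    (hPL : RowDots w K XL v PL BL) (hPR : RowDots w K XR v PR BR) (hv : v.length = K) (hV : sumList v = V)
    {i j : ℕ} (hi : i < BL) (hj : j < BR) :
    MI.mem S (∑ t ∈ Finset.range K, f i t * g j t * ((v.getD t 0 : ℝ) / 2 ^ cv))
      (gramDataBox S w K cL cR cv ρL ρR (2 ^ (w - 1)) (2 ^ (w - 1)) XL XR PL PR v V i j) := by
  set o : ℕ := 2 ^ (w - 1) with ho
  set uL : ℝ := 1 / 2 ^ cL with huL
  set uR : ℝ := 1 / 2 ^ cR with huR
  set uv : ℝ := 1 / 2 ^ cv with huv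
  have huL0 : 0 < uL := by rw [huL]; positivity
  have huR0 : 0 < uR := by rw [huR]; positivity
  have huv0 : 0 < uv := by rw [huv]; positivity
  set xL : List ℕ := unpackNats w (XL.getD i 0) K with hxL
  set xR : List ℕ := unpackNats w (XR.getD j 0) K with hxR
  have hlenL : xL.length = K := length_unpackNats _ _ _
  have hlenR : xR.length = K := length_unpackNats _ _ _
  -- real digit functions and the signed values
  set dL : ℕ → ℝ := fun t ↦ (xL.getD t 0 : ℝ) - o with hdL
  set dR : ℕ → ℝ := fun t ↦ (xR.getD t 0 : ℝ) - o with hdR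
  set wt : ℕ → ℝ := fun t ↦ (v.getD t 0 : ℝ) with hw'
  have hw0 : ∀ t, 0 ≤ wt t := fun t ↦ by simp only [hw']; positivity
  have htwo : (2 : ℝ) ^ w = 2 * o := by
    rw [ho]; push_cast
    rw [← pow_succ']; congr 1; omega
  have hdig : ∀ (r t : ℕ), |((unpackNats w r K).getD t 0 : ℝ) - o| ≤ o := by
    intro r t
    have h1 : ((unpackNats w r K).getD t 0 : ℝ) < 2 ^ w := by exact_mod_cast unpackNats_getD_lt w r K t
    have h0 : (0 : ℝ) ≤ (unpackNats w r K).getD t 0 := by positivity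
    rw [htwo] at h1
    rw [abs_le]; constructor <;> linarith
  have hbL : ∀ t, |dL t| ≤ o := fun t ↦ hdig _ t
  have hbR : ∀ t, |dR t| ≤ o := fun t ↦ hdig _ t
  -- the enclosures, restated with dL/dR
  have hAL : ∀ t < K, |f i t - dL t * uL| ≤ ρL * uL := by
    intro t ht
    have h := hL i hi t ht
    simp only [digit, ← hxL, ← huL] at h
    have e : (((xL.getD t 0 : ℤ) - (o : ℕ) : ℤ) : ℝ) = dL t := by simp only [hdL]; push_cast; ring
    rwa [e] at h
  have hAR : ∀ t < K, |g j t - dR t * uR| ≤ ρR * uR := by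
    intro t ht
    have h := hR j hj t ht
    simp only [digit, ← hxR, ← huR] at h
    have e : (((xR.getD t 0 : ℤ) - (o : ℕ) : ℤ) : ℝ) = dR t := by simp only [hdR]; push_cast; ring
    rwa [e] at h
  -- the exact integer centre equals the real weighted sum of the signed digits
  set Tz : ℝ := ∑ t ∈ Finset.range K, wt t * (dL t * dR t) with hTz
  set cz : ℤ := (dotN3 v xL xR : ℤ) - (o * PL.getD i 0 : ℕ) - (o * PR.getD j 0 : ℕ) + (o * o * V : ℕ) with hcz
  have hVeq : (V : ℝ) = ∑ t ∈ Finset.range K, wt t := by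
    rw [hw', ← sumList_eq_sum v K hv, hV]
  have hczR : (cz : ℝ) = Tz := by
    have h1 : ((dotN3 v xL xR : ℕ) : ℝ) = ∑ t ∈ Finset.range K, wt t * ((xL.getD t 0 : ℝ) * (xR.getD t 0 : ℝ)) :=
      dotN3_eq_sum v xL xR K hv hlenL hlenR
    have h2 : ((PL.getD i 0 : ℕ) : ℝ) = ∑ t ∈ Finset.range K, wt t * (xL.getD t 0 : ℝ) := by
      rw [← hPL i hi]; exact dotN2_eq_sum v xL K hv hlenL
    have h3 : ((PR.getD j 0 : ℕ) : ℝ) = ∑ t ∈ Finset.range K, wt t * (xR.getD t 0 : ℝ) := by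
      rw [← hPR j hj]; exact dotN2_eq_sum v xR K hv hlenR
    have h4 : ∀ t, wt t * (dL t * dR t)
        = wt t * ((xL.getD t 0 : ℝ) * (xR.getD t 0 : ℝ)) - (o : ℝ) * (wt t * (xL.getD t 0 : ℝ))
          - (o : ℝ) * (wt t * (xR.getD t 0 : ℝ)) + (o : ℝ) * o * wt t := by
      intro t; simp only [hdL, hdR]; ring
    rw [hcz, hTz]
    push_cast
    rw [h1, h2, h3, hVeq]
    simp only [h4, Finset.sum_add_distrib, Finset.sum_sub_distrib, ← Finset.mul_sum]
  -- per-term error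
  have herr : ∀ t < K, |f i t * g j t - dL t * uL * (dR t * uR)| ≤ (ρL * o + ρR * o + ρL * ρR : ℝ) * (uL * uR) := by
    intro t ht
    have hA := hAL t ht
    have hB := hAR t ht
    have hCb : |dR t| * |uR| ≤ o * uR := by
      rw [abs_of_pos huR0]; exact mul_le_mul_of_nonneg_right (hbR t) huR0.le
    have hDb : |dL t| * |uL| ≤ o * uL := by
      rw [abs_of_pos huL0]; exact mul_le_mul_of_nonneg_right (hbL t) huL0.le
    have e : f i t * g j t - dL t * uL * (dR t * uR)
        = (f i t - dL t * uL) * (g j t - dR t * uR) + (f i t - dL t * uL) * (dR t * uR)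
          + (dL t * uL) * (g j t - dR t * uR) := by ring
    rw [e]
    calc |(f i t - dL t * uL) * (g j t - dR t * uR) + (f i t - dL t * uL) * (dR t * uR)
            + (dL t * uL) * (g j t - dR t * uR)|
        ≤ |(f i t - dL t * uL) * (g j t - dR t * uR)| + |(f i t - dL t * uL) * (dR t * uR)|
            + |(dL t * uL) * (g j t - dR t * uR)| := abs_add_three _ _ _
      _ = |f i t - dL t * uL| * |g j t - dR t * uR| + |f i t - dL t * uL| * (|dR t| * |uR|)
            + |dL t| * |uL| * |g j t - dR t * uR| := by simp only [abs_mul]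
      _ ≤ (ρL * uL) * (ρR * uR) + (ρL * uL) * (o * uR) + (o * uL) * (ρR * uR) := by
          gcongr ?_ * ?_ + ?_ * ?_ + ?_ * ?_
      _ = (ρL * o + ρR * o + ρL * ρR : ℝ) * (uL * uR) := by ring
  -- sum of the errors
  have hvs : ∑ t ∈ Finset.range K, wt t ≤ V := le_of_eq hVeq.symm
  set E : ℕ := V * (ρL * o + ρR * o + ρL * ρR) with hE
  have hsum : |∑ t ∈ Finset.range K, f i t * g j t * (wt t / 2 ^ cv) - Tz * (uL * uR * uv)|
      ≤ (E : ℝ) * (uL * uR * uv) := by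
    have e1 : ∑ t ∈ Finset.range K, f i t * g j t * (wt t / 2 ^ cv) - Tz * (uL * uR * uv)
        = ∑ t ∈ Finset.range K, wt t * uv * (f i t * g j t - dL t * uL * (dR t * uR)) := by
      rw [hTz, Finset.sum_mul, ← Finset.sum_sub_distrib]
      refine Finset.sum_congr rfl fun t _ ↦ ?_
      rw [huv]; ring
    rw [e1]
    calc |∑ t ∈ Finset.range K, wt t * uv * (f i t * g j t - dL t * uL * (dR t * uR))|
        ≤ ∑ t ∈ Finset.range K, |wt t * uv * (f i t * g j t - dL t * uL * (dR t * uR))| := Finset.abs_sum_le_sum_abs _ _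
      _ ≤ ∑ t ∈ Finset.range K, wt t * uv * ((ρL * o + ρR * o + ρL * ρR : ℝ) * (uL * uR)) := by
          refine Finset.sum_le_sum fun t ht ↦ ?_
          rw [abs_mul, abs_of_nonneg (mul_nonneg (hw0 t) huv0.le)]
          exact mul_le_mul_of_nonneg_left (herr t (Finset.mem_range.mp ht)) (mul_nonneg (hw0 t) huv0.le)
      _ = (∑ t ∈ Finset.range K, wt t) * ((ρL * o + ρR * o + ρL * ρR : ℝ) * (uL * uR * uv)) := by
          rw [Finset.sum_mul]; exact Finset.sum_congr rfl fun t _ ↦ by ring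
      _ ≤ (V : ℝ) * ((ρL * o + ρR * o + ρL * ρR : ℝ) * (uL * uR * uv)) :=
          mul_le_mul_of_nonneg_right hvs (by positivity)
      _ = (E : ℝ) * (uL * uR * uv) := by rw [hE]; push_cast; ring
  -- the unit and the two endpoints
  have hU : uL * uR * uv = 1 / (2 : ℝ) ^ (cL + cR + cv) := by
    rw [huL, huR, huv, pow_add, pow_add]; field_simp
  rw [hU] at hsum
  have h2 : (0 : ℝ) < (2 : ℝ) ^ (cL + cR + cv) := by positivity
  rw [abs_le] at hsum
  obtain ⟨hlo, hhi⟩ := hsum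
  have hloZ : ((cz - (E : ℕ) : ℤ) : ℝ) = Tz - E := by push_cast; rw [hczR]
  have hhiZ : ((cz + (E : ℕ) : ℤ) : ℝ) = Tz + E := by push_cast; rw [hczR]
  unfold gramDataBox
  refine MI.mem_span (MI.mem_ofFrac S (cz - (E : ℕ)) (q := 2 ^ (cL + cR + cv)) (by positivity))
    (MI.mem_ofFrac S (cz + (E : ℕ)) (q := 2 ^ (cL + cR + cv)) (by positivity)) ?_ ?_
  · rw [hloZ]; push_cast
    rw [div_le_iff₀ h2]
    have := mul_le_mul_of_nonneg_right hlo h2.le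
    have e2 : (E : ℝ) * (1 / 2 ^ (cL + cR + cv)) * 2 ^ (cL + cR + cv) = E := by field_simp
    have e3 : Tz * (1 / 2 ^ (cL + cR + cv)) * 2 ^ (cL + cR + cv) = Tz := by field_simp
    nlinarith [e2, e3]
  · rw [hhiZ]; push_cast
    rw [le_div_iff₀ h2]
    have := mul_le_mul_of_nonneg_right hhi h2.le
    have e2 : (E : ℝ) * (1 / 2 ^ (cL + cR + cv)) * 2 ^ (cL + cR + cv) = E := by field_simp
    have e3 : Tz * (1 / 2 ^ (cL + cR + cv)) * 2 ^ (cL + cR + cv) = Tz := by field_simp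
    nlinarith [e2, e3]


/-! ## Reciprocal dyadic column weights `w_t = 2^{cv}/v_t` -/

/-- The weight function of a reciprocal-weight list: `w(B + t) = 2^{cv}/v_t`. [cite: Moore1966, Ch. 3 (interval arithmetic: inclusion property)] -/
noncomputable def wvF (v : List ℕ) (cv B : ℕ) : ℕ → ℝ := fun m ↦ (2 : ℝ) ^ cv / (v.getD (m - B) 0 : ℝ)

/-- `1/w(B+t) = v_t/2^{cv}`. [cite: Moore1966, Ch. 3 (interval arithmetic: inclusion property)] -/
theorem one_div_wvF (v : List ℕ) (cv B t : ℕ) : 1 / wvF v cv B (B + t) = (v.getD t 0 : ℝ) / 2 ^ cv := by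
  simp only [wvF, Nat.add_sub_cancel_left, one_div_div]

/-- **Even reciprocal-weight certificate**: for every `t < K`, `0 < v_t` and `2^{cv}·S ≤ v_t · (devEvenBox at mode B+t).lo`
(light record at mode `B + t`). [cite: Moore1966, Ch. 3 (interval arithmetic: inclusion property)] -/
def checkWeightsEvenV (S : ℕ) (C : Consts) (F : FDConsts) (ctab : List IdxRec) (Be K cv : ℕ) (v : List ℕ)
    (p q : ℕ) : Bool :=
  (List.range K).all fun t ↦
    decide (0 < v.getD t 0) &&
      decide ((2 ^ cv : ℤ) * (S : ℤ) ≤ (v.getD t 0 : ℤ) * (devEvenBox S C F (tget ctab (Be + t)) (Be + t) p q).lo)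

/-- Unpacking `checkWeightsEvenV`. [cite: Moore1966, Ch. 3 (interval arithmetic: inclusion property)] -/
theorem weightsEvenV_of_check {F : FDConsts} {Be K cv p q : ℕ} {v : List ℕ}
    (h : checkWeightsEvenV S C F ctab Be K cv v p q = true) (t : ℕ) (ht : t < K) :
    0 < v.getD t 0 ∧
      (2 ^ cv : ℤ) * (S : ℤ) ≤ (v.getD t 0 : ℤ) * (devEvenBox S C F (tget ctab (Be + t)) (Be + t) p q).lo := by
  unfold checkWeightsEvenV at h
  rw [List.all_eq_true] at h
  have h1 := h t (List.mem_range.mpr ht)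
  rw [Bool.and_eq_true, decide_eq_true_eq, decide_eq_true_eq] at h1
  exact h1

/-- **Odd reciprocal-weight certificate** (arctan far diagonal): for every `t < K`, with `l = Bo + t` and the light
record at mode `l + 1`: `0 < v_t`, `rs_t/q ≤ √(Bo/(l+1))` and `2^{cv}·S ≤ v_t · Y.lo` for the box
`Y = devOddABox …`. [cite: Moore1966, Ch. 3 (interval arithmetic: inclusion property)] -/
def checkWeightsOddV (S Kser : ℕ) (C : Consts) (F : FDConsts) (ctab : List IdxRec) (Bo K cv : ℕ) (v rs : List ℕ)
    (q p q' : ℕ) : Bool :=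
  (List.range K).all fun t ↦
    decide (0 < v.getD t 0) && checkSqrtLower Bo (Bo + t + 1) (rs.getD t 0) q &&
    match devOddABox S Kser C F (tget ctab (Bo + t + 1)) (Bo + t) Bo (rs.getD t 0) q p q' with
    | some Y => decide ((2 ^ cv : ℤ) * (S : ℤ) ≤ (v.getD t 0 : ℤ) * Y.lo)
    | none => false

/-- Unpacking `checkWeightsOddV`. [cite: Moore1966, Ch. 3 (interval arithmetic: inclusion property)] -/
theorem weightsOddV_of_check {F : FDConsts} {Bo K cv Kser q p q' : ℕ} {v rs : List ℕ}
    (h : checkWeightsOddV S Kser C F ctab Bo K cv v rs q p q' = true) (t : ℕ) (ht : t < K) :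
    0 < v.getD t 0 ∧ checkSqrtLower Bo (Bo + t + 1) (rs.getD t 0) q = true ∧
      ∃ Y, devOddABox S Kser C F (tget ctab (Bo + t + 1)) (Bo + t) Bo (rs.getD t 0) q p q' = some Y ∧
        (2 ^ cv : ℤ) * (S : ℤ) ≤ (v.getD t 0 : ℤ) * Y.lo := by
  unfold checkWeightsOddV at h
  rw [List.all_eq_true] at h
  have h1 := h t (List.mem_range.mpr ht)
  simp only [Bool.and_eq_true, decide_eq_true_eq] at h1
  obtain ⟨⟨hpos, hsq⟩, hbox⟩ := h1
  split at hbox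
  · rename_i Y hY
    simp only [decide_eq_true_eq] at hbox
    exact ⟨hpos, hsq, Y, hY, hbox⟩
  · simp at hbox

/-- From `2^{cv}·S ≤ v·lo` and `lo ≤ d̂·S` (`v > 0`): `0 < 2^{cv}/v ≤ d̂`. [cite: Moore1966, Ch. 3 (interval arithmetic: inclusion property)] -/
theorem wv_le_of_lo (hS : 0 < S) {cv vt : ℕ} {lo : ℤ} {d : ℝ} (hv : 0 < vt)
    (h : (2 ^ cv : ℤ) * (S : ℤ) ≤ (vt : ℤ) * lo) (hlo : (lo : ℝ) ≤ d * S) :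
    0 < (2 : ℝ) ^ cv / vt ∧ (2 : ℝ) ^ cv / vt ≤ d := by
  have hSr : (0 : ℝ) < S := by exact_mod_cast hS
  have hvr : (0 : ℝ) < vt := by exact_mod_cast hv
  refine ⟨by positivity, ?_⟩
  rw [div_le_iff₀ hvr]
  have h' : (2 : ℝ) ^ cv * S ≤ vt * lo := by exact_mod_cast h
  nlinarith

/-! ## The Schur rows against an abstract subtracted box -/

/-- The real Schur entry with an abstract subtracted part `Usub`. [cite: Yoshida1992HermitianForms, §7 pp. 305–312 (the finite certificate)] -/
noncomputable def schurEntryG (M Usub : ℕ → ℕ → ℝ) (i j : ℕ) : ℝ := M i j - Usub i j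

/-- Check a band of rows `i₀ ≤ i < i₀ + k` of `sectorBoxSym(i,j) − sub(i,j)` against the claimed midpoints `DS`
(unit `2^{−c}`, radius `ρS`); columns `j < B`, or `j ≤ i` only when `lower = true`.
[cite: Moore1966, Ch. 3 (interval arithmetic: inclusion property)] -/
def checkSchurBandG (S c : ℕ) (ρS : ℤ) (C : Consts) (tab : List IdxRec) (odd : Bool) (B : ℕ)
    (sub : ℕ → ℕ → MI) (DS : List (List ℤ)) (lower : Bool) (i0 k : ℕ) : Bool :=
  (List.range k).all fun di ↦ (List.range (if lower then i0 + di + 1 else B)).all fun j ↦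
    enclCheck S c ρS (PsdDyadic.getMZ DS (i0 + di) j) ((sectorBoxSym odd S C tab (i0 + di) j).sub (sub (i0 + di) j))

/-- **Soundness of `checkSchurBandG`**: on the band (and `j ≤ i` if `lower`), `DS` encloses `M^σ(i,j) − Usub(i,j)`
within `ρS·2^{−c}`, given `Usub i j ∈ sub i j`. [cite: Yoshida1992HermitianForms, §7 pp. 305–312 (the finite certificate)] -/
theorem near_schurG_of_check (hS : 0 < S) (ha0 : 0 < a) (hks : PrimeData a ks) (hC : ConstsValid S a ks C)
    {B : ℕ} (hT : TabValid S a ks (B + 1) tab) {odd : Bool} {c : ℕ} {ρS : ℤ} {sub : ℕ → ℕ → MI}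
    {Usub : ℕ → ℕ → ℝ} (hsub : ∀ i < B, ∀ j < B, MI.mem S (Usub i j) (sub i j)) {DS : List (List ℤ)}
    {lower : Bool} {i0 k : ℕ} (h : checkSchurBandG S c ρS C tab odd B sub DS lower i0 k = true)
    {i j : ℕ} (hi : i0 ≤ i) (hik : i < i0 + k) (hiB : i < B) (hj : j < B) (hjl : lower = true → j ≤ i) :
    |schurEntryG (sectorKernel odd (gramCoeff a)) Usub i j - (PsdDyadic.getMZ DS i j : ℝ) * (1 / 2 ^ c)|
      ≤ (ρS : ℝ) * (1 / 2 ^ c) := by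
  unfold checkSchurBandG at h
  rw [List.all_eq_true] at h
  have h1 := h (i - i0) (List.mem_range.mpr (by omega))
  rw [show i0 + (i - i0) = i by omega, List.all_eq_true] at h1
  have hjr : j < (if lower then i + 1 else B) := by
    cases lower
    · simpa using hj
    · have := hjl rfl; simp; omega
  have h2 := h1 j (List.mem_range.mpr hjr)
  refine abs_sub_le_of_enclCheck hS h2 ?_
  unfold schurEntryG
  exact MI.mem_sub (mem_sectorBoxSym hS ha0 hks hC hT odd (i := i) (j := j) (by omega) (by omega)) (hsub i hiB j hj)

/-- A band result as a predicate: rows `i < n` (columns `j < B`, or `j ≤ i` when `lower`) of `M − Usub` are enclosed by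
`DS`. [cite: Moore1966, Ch. 3 (interval arithmetic: inclusion property)] -/
def SchurNearG (M Usub : ℕ → ℕ → ℝ) (B c : ℕ) (ρS : ℤ) (DS : List (List ℤ)) (lower : Bool) (n : ℕ) : Prop :=
  ∀ i < n, i < B → ∀ j < B, (lower = true → j ≤ i) →
    |schurEntryG M Usub i j - (PsdDyadic.getMZ DS i j : ℝ) * (1 / 2 ^ c)| ≤ (ρS : ℝ) * (1 / 2 ^ c)

/-- No rows yet. [cite: Moore1966, Ch. 3 (interval arithmetic: inclusion property)] -/
theorem SchurNearG.zero {M Usub : ℕ → ℕ → ℝ} {B c : ℕ} {ρS : ℤ} {DS : List (List ℤ)} {lower : Bool} :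
    SchurNearG M Usub B c ρS DS lower 0 := fun _ h ↦ absurd h (by omega)

/-- Glue a further row band `[n, n + k)`. [cite: Moore1966, Ch. 3 (interval arithmetic: inclusion property)] -/
theorem SchurNearG.extend {M Usub : ℕ → ℕ → ℝ} {B c : ℕ} {ρS : ℤ} {DS : List (List ℤ)} {lower : Bool} {n k : ℕ}
    (h1 : SchurNearG M Usub B c ρS DS lower n)
    (h2 : ∀ i, n ≤ i → i < n + k → i < B → ∀ j < B, (lower = true → j ≤ i) →
      |schurEntryG M Usub i j - (PsdDyadic.getMZ DS i j : ℝ) * (1 / 2 ^ c)| ≤ (ρS : ℝ) * (1 / 2 ^ c)) :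
    SchurNearG M Usub B c ρS DS lower (n + k) :=
  fun i hi hiB j hj hjl ↦ if h : i < n then h1 i h hiB j hj hjl else h2 i (by omega) hi hiB j hj hjl

/-- **A checked band extends the predicate** (the generated files chain this lemma band by band).
[cite: Yoshida1992HermitianForms, §7 pp. 305–312 (the finite certificate)] -/
theorem SchurNearG.extend_of_check (hS : 0 < S) (ha0 : 0 < a) (hks : PrimeData a ks) (hC : ConstsValid S a ks C)
    {B : ℕ} (hT : TabValid S a ks (B + 1) tab) {odd : Bool} {c : ℕ} {ρS : ℤ} {sub : ℕ → ℕ → MI}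
    {Usub : ℕ → ℕ → ℝ} (hsub : ∀ i < B, ∀ j < B, MI.mem S (Usub i j) (sub i j)) {DS : List (List ℤ)}
    {lower : Bool} {n k : ℕ} (h1 : SchurNearG (sectorKernel odd (gramCoeff a)) Usub B c ρS DS lower n)
    (h : checkSchurBandG S c ρS C tab odd B sub DS lower n k = true) :
    SchurNearG (sectorKernel odd (gramCoeff a)) Usub B c ρS DS lower (n + k) :=
  h1.extend fun _ hi hik hiB _ hj hjl ↦ near_schurG_of_check hS ha0 hks hC hT hsub h hi hik hiB hj hjl

/-- **Symmetric completion**: a lower-triangle enclosure of a symmetric matrix by symmetric midpoints is a full one.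
[cite: Moore1966, Ch. 3 (interval arithmetic: inclusion property)] -/
theorem SchurNearG.of_lower {M Usub : ℕ → ℕ → ℝ} {B c : ℕ} {ρS : ℤ} {DS : List (List ℤ)}
    (h : SchurNearG M Usub B c ρS DS true B) (hM : ∀ i j, M i j = M j i) (hU : ∀ i < B, ∀ j < B, Usub i j = Usub j i)
    (hDS : ∀ i < B, ∀ j < B, PsdDyadic.getMZ DS i j = PsdDyadic.getMZ DS j i) :
    SchurNearG M Usub B c ρS DS false B := by
  intro i hi hiB j hj _
  by_cases hji : j ≤ i
  · exact h i hi hiB j hj (fun _ ↦ hji)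
  · have h' := h j hj hj i hiB (fun _ ↦ by omega)
    unfold schurEntryG at h' ⊢
    rwa [hM j i, hU j hj i hiB, hDS j hj i hiB] at h'

/-! ## The subtracted part of the column-band layer: `U₁` from column data + a factored tail `U₂ = Σ_r φ_r ψ_rᵀ + diag` -/

/-- The real subtracted part `U₁(i,j) + U₂(i,j)`: weighted column Gram + factored tail + tail diagonal.
[cite: Yoshida1992HermitianForms, §7 pp. 305–312 (the finite certificate)] -/
noncomputable def usubCB (M φ ψ : ℕ → ℕ → ℝ) (dg : ℕ → ℝ) (B K cv : ℕ) (v : List ℕ) (R2 : ℕ) (i j : ℕ) : ℝ :=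
  (∑ t ∈ Finset.range K, M i (B + t) * M j (B + t) * ((v.getD t 0 : ℝ) / 2 ^ cv))
    + (∑ r ∈ Finset.range R2, φ i r * ψ j r * ((((List.replicate R2 (1 : ℕ)).getD r 0 : ℕ) : ℝ) / 2 ^ 0))
    + (if i = j then dg i else 0)

/-- The factored-tail sum is the plain `Σ_r φ_r(i) ψ_r(j)`. [cite: Moore1966, Ch. 3 (interval arithmetic: inclusion property)] -/
theorem sum_replicate_one_eq {φ ψ : ℕ → ℕ → ℝ} (R2 i j : ℕ) :
    ∑ r ∈ Finset.range R2, φ i r * ψ j r * ((((List.replicate R2 (1 : ℕ)).getD r 0 : ℕ) : ℝ) / 2 ^ 0)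
      = ∑ r ∈ Finset.range R2, φ i r * ψ j r := by
  refine Finset.sum_congr rfl fun r hr ↦ ?_
  rw [List.getD_eq_getElem?_getD, List.getElem?_replicate_of_lt (Finset.mem_range.mp hr)]
  simp

/-- The box of `usubCB`: two `gramDataBox`es (columns: word width `w`, `K` digits, unit `2^{−cc}`, radius `ρc`,
reciprocal weights `v`; tail factors: word width `wφ`, `R2` digits, units `2^{−cφ}`, `2^{−cψ}`, unit weights) and the
diagonal box. [cite: Moore1966, Ch. 3 (interval arithmetic: inclusion property)] -/
def subBoxCB (S w K cc cv ρc : ℕ) (XP P v : List ℕ) (V : ℕ) (wφ R2 cφ cψ ρφ ρψ : ℕ) (Φ Ψ Pφ Pψ : List ℕ)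
    (dgBox : ℕ → MI) (i j : ℕ) : MI :=
  ((gramDataBox S w K cc cc cv ρc ρc (2 ^ (w - 1)) (2 ^ (w - 1)) XP XP P P v V i j).add
    (gramDataBox S wφ R2 cφ cψ 0 ρφ ρψ (2 ^ (wφ - 1)) (2 ^ (wφ - 1)) Φ Ψ Pφ Pψ (List.replicate R2 1) R2 i j)).add
      (if i = j then dgBox i else MI.ofInt S 0)

/-- [cite: Moore1966, Ch. 3 (interval arithmetic: inclusion property)] -/
theorem sumList_replicate_one : ∀ n : ℕ, sumList (List.replicate n 1) = n
  | 0 => rfl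
  | n + 1 => by rw [List.replicate_succ, sumList, sumList_replicate_one n]; omega

/-- **`usubCB ∈ subBoxCB`** from the certified column data, the certified tail factors and the diagonal boxes.
[cite: Yoshida1992HermitianForms, §7 pp. 305–312 (the finite certificate)] -/
theorem mem_subBoxCB (S : ℕ) {M φ ψ : ℕ → ℕ → ℝ} {dg : ℕ → ℝ} {B K w cc cv ρc : ℕ} {XP P v : List ℕ} {V : ℕ}
    {wφ R2 cφ cψ ρφ ρψ : ℕ} {Φ Ψ Pφ Pψ : List ℕ} {dgBox : ℕ → MI} (hw : 1 ≤ w) (hwφ : 1 ≤ wφ)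
    (hCD : DataNear (fun i t ↦ M i (B + t)) B K w (2 ^ (w - 1)) cc ρc XP) (hP : RowDots w K XP v P B)
    (hv : v.length = K) (hV : sumList v = V)
    (hφ : DataNear φ B R2 wφ (2 ^ (wφ - 1)) cφ ρφ Φ) (hψ : DataNear ψ B R2 wφ (2 ^ (wφ - 1)) cψ ρψ Ψ)
    (hPφ : RowDots wφ R2 Φ (List.replicate R2 1) Pφ B) (hPψ : RowDots wφ R2 Ψ (List.replicate R2 1) Pψ B)
    (hdg : ∀ i < B, MI.mem S (dg i) (dgBox i)) {i j : ℕ} (hi : i < B) (hj : j < B) :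
    MI.mem S (usubCB M φ ψ dg B K cv v R2 i j)
      (subBoxCB S w K cc cv ρc XP P v V wφ R2 cφ cψ ρφ ρψ Φ Ψ Pφ Pψ dgBox i j) := by
  unfold usubCB subBoxCB
  refine MI.mem_add (MI.mem_add (mem_gramDataBox S hw hCD hCD hP hP hv hV hi hj) ?_) ?_
  · exact mem_gramDataBox S hwφ hφ hψ hPφ hPψ (List.length_replicate) (sumList_replicate_one R2) hi hj
  · by_cases hij : i = j
    · rw [if_pos hij, if_pos hij]; exact hdg i hi
    · rw [if_neg hij, if_neg hij]; exact_mod_cast MI.mem_ofInt S 0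

end Encl

end Literature.NumberTheory.LFunctions.Yoshida1992
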